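import Summits.Ventures.HodgeRepro.Tier4.Common.AdelicDefs
import Summits.Ventures.HodgeRepro.Tier4.Line1.PlaneDefs
import Summits.Ventures.HodgeRepro.Tier4.Line1.RotationCore
import Summits.Ventures.HodgeRepro.Tier4.Line1.RationalRotation

/-!
# Tier4/Line1/WittPlane — LINE L1: Witt for the hermitian plane, rung C6 of the cocompactness cut (t4-L1-p3)

Blind re-derivation cell `pub-hodge-repro`, Tier 4 (README §9–§10), seat t4-L1-p3; the lead's S12733 assignment
(C6 of t4-L1-p5's cut of the R-c wall, statement verbatim from proofs/t4-L1-p5/I1c-rungs-sig.lean).  Two non-zero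
rational row vectors of the same hermitian norm are conjugate under `U(W)(k)` — WITHOUT Witt's theorem: an explicit
`SU(2)`-type matrix.  Column picture (`Om := Ωᵀ`, the column-genuine data of `IsGenuineRow`): for `x ≠ 0` choose
`x′ ≠ 0` orthogonal to `x, Om x` (a kernel of dimension `≥ 2`; `Om`-stable by the hermitian relation); on the adapted
basis `S = (x, Om x, x′, Om x′)` the Gram matrix is `G = diag(α, dα, α′, dα′)` with `α = β(x,x)`, `α′ = β(x′,x′)` non-zero
(`IsDefinite`), so `S` is invertible and `y = S (p, q, p′, q′)`; the hypothesis `β(y,y) = β(x,x)` reads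
`N(λ)α + N(μ)α′ = α` for `λ = p + qΩ`, `μ = p′ + q′Ω`; the `E′`-matrix `[[λ, −μ̄α′/α], [μ, λ̄]]` is then an isometry
(`witt_isometry`: sixteen polynomial entries modulo that one constraint), commutes with `diag(J, J)` (`witt_comm_J`),
and sends `x` to `y`; `h := S R S⁻¹`, `γ := hᵀ` (the row convention of typer-2's `unitaryGroup`), lifted to
`rationalPoints W`; `RingHom.map_vecMul` transports `x ᵥ* γ = y` to the adeles.  Mathlib + the line's landed modules
only; no printed input.

Nothing here says anything about the status of the Hodge conjecture for CM abelian varieties, which is NOT proved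
(HC_CM is NOT proved by anyone in this repository).
-/

set_option autoImplicit false

noncomputable section

namespace Summit.Ventures.HodgeRepro.Tier4.Line1.Rot

open Matrix

variable {k : Type} [Field k] [CharZero k]

omit [CharZero k] in
/-- the `SU(2)`-type block matrix commutes with `diag(J, J)`. -/
theorem witt_comm_J (p q p' q' ν₁ ν₂ d : k) :
    Matrix.of ![![p, -(d * q), ν₁, -(d * ν₂)], ![q, p, ν₂, ν₁], ![p', -(d * q'), p, d * q],
        ![q', p', -q, p]] *
        Matrix.of ![![0, -d, 0, 0], ![1, 0, 0, 0], ![0, 0, 0, -d], ![0, 0, 1, 0]] =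
      Matrix.of ![![0, -d, 0, 0], ![1, 0, 0, 0], ![0, 0, 0, -d], ![0, 0, 1, 0]] *
        Matrix.of ![![p, -(d * q), ν₁, -(d * ν₂)], ![q, p, ν₂, ν₁], ![p', -(d * q'), p, d * q],
          ![q', p', -q, p]] := by
  ext i j
  fin_cases i <;> fin_cases j <;> simp [Matrix.mul_apply, Fin.sum_univ_four] <;> ring

omit [CharZero k] in
/-- the `SU(2)`-type block matrix with `ν = −μ̄ α′/α` (given as `ν₁ α = −p′α′`, `ν₂ α = q′α′`) and `ρ = λ̄` is an isometry
of `diag(α, dα, α′, dα′)` when `N(λ)α + N(μ)α′ = α`. -/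
theorem witt_isometry {p q p' q' ν₁ ν₂ d a a' : k} (ha : a ≠ 0)
    (hc : p * p * a + d * (q * q) * a + p' * p' * a' + d * (q' * q') * a' = a)
    (hν₁ : ν₁ * a = -(p' * a')) (hν₂ : ν₂ * a = q' * a') :
    (Matrix.of ![![p, -(d * q), ν₁, -(d * ν₂)], ![q, p, ν₂, ν₁], ![p', -(d * q'), p, d * q],
        ![q', p', -q, p]])ᵀ *
        Matrix.diagonal ![a, d * a, a', d * a'] *
        Matrix.of ![![p, -(d * q), ν₁, -(d * ν₂)], ![q, p, ν₂, ν₁], ![p', -(d * q'), p, d * q],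
          ![q', p', -q, p]] =
      Matrix.diagonal ![a, d * a, a', d * a'] := by
  ext i j
  fin_cases i <;> fin_cases j <;> simp [Matrix.mul_apply, Fin.sum_univ_four, Matrix.diagonal] <;>
    apply mul_left_cancel₀ ha <;>
    first
    | linear_combination a * hc
    | linear_combination d * a * hc
    | linear_combination (ν₁ * a - p' * a') * hν₁ + d * (ν₂ * a + q' * a') * hν₂ + a' * hc
    | linear_combination d * ((ν₁ * a - p' * a') * hν₁ + d * (ν₂ * a + q' * a') * hν₂ + a' * hc)
    | linear_combination (a * p) * hν₁ + (d * a * q) * hν₂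
    | linear_combination (d * a * q) * hν₁ - (d * a * p) * hν₂
    | linear_combination -(d * a * q) * hν₁ + (d * a * p) * hν₂
    | linear_combination (d * a * p) * hν₁ + (d * d * a * q) * hν₂
    | ring

omit [CharZero k] in
/-- the quadratic form of a diagonal `4 × 4` matrix. -/
theorem dotProduct_diagonal_mulVec (c : Fin 4 → k) (a b e f : k) :
    c ⬝ᵥ (Matrix.diagonal ![a, b, e, f] *ᵥ c) =
      c 0 * c 0 * a + b * (c 1 * c 1) + c 2 * c 2 * e + f * (c 3 * c 3) := by
  simp [dotProduct, Matrix.mulVec_diagonal, Fin.sum_univ_four]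
  ring

omit [CharZero k] in
/-- a non-zero vector `β`-orthogonal to `x` and `Om x` exists (the kernel of a map to `k²` has dimension `≥ 2`). -/
theorem exists_orth_ne_zero (B Om : Matrix (Fin 4) (Fin 4) k) (x : Fin 4 → k) :
    ∃ x' : Fin 4 → k, x' ≠ 0 ∧ x' ⬝ᵥ (B *ᵥ x) = 0 ∧ x' ⬝ᵥ (B *ᵥ (Om *ᵥ x)) = 0 := by
  set A : Matrix (Fin 2) (Fin 4) k := Matrix.of ![B *ᵥ x, B *ᵥ (Om *ᵥ x)] with hA
  have hrank := LinearMap.finrank_range_add_finrank_ker A.mulVecLin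
  have hle : Module.finrank k (LinearMap.range A.mulVecLin) ≤ 2 := by
    have := Submodule.finrank_le (LinearMap.range A.mulVecLin)
    simpa using this
  have hdom : Module.finrank k (Fin 4 → k) = 4 := by simp
  rw [hdom] at hrank
  have hker : LinearMap.ker A.mulVecLin ≠ ⊥ := by
    intro h
    rw [h, finrank_bot] at hrank
    omega
  obtain ⟨x', hx'mem, hx'⟩ := Submodule.exists_mem_ne_zero_of_ne_bot hker
  rw [LinearMap.mem_ker, mulVecLin_apply] at hx'mem
  refine ⟨x', hx', ?_, ?_⟩
  · have := congrFun hx'mem 0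
    simp only [A, Matrix.mulVec, Matrix.of_apply, Matrix.cons_val_zero, Pi.zero_apply] at this
    rw [dotProduct_comm]
    exact this
  · have := congrFun hx'mem 1
    simp only [A, Matrix.mulVec, Matrix.of_apply, Matrix.cons_val_one, Pi.zero_apply] at this
    rw [dotProduct_comm]
    exact this

/-- **Witt for the plane, column picture**: for an anisotropic column-hermitian plane `(B, Om)`, two non-zero vectors of
the same norm are related by an `Om`-linear `B`-isometry. -/
theorem exists_isometry_mulVec_eq {B Om : Matrix (Fin 4) (Fin 4) k} {d : k} (hB : Bᵀ = B)
    (hherm : Omᵀ * B = -(B * Om)) (hOm : Om * Om = -(d • (1 : Matrix (Fin 4) (Fin 4) k)))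
    (hd : ¬ IsSquare (-d)) (hdef : ∀ v : Fin 4 → k, v ≠ 0 → v ⬝ᵥ (B *ᵥ v) ≠ 0)
    {x y : Fin 4 → k} (hx : x ≠ 0) (hxy : x ⬝ᵥ (B *ᵥ x) = y ⬝ᵥ (B *ᵥ y)) :
    ∃ h : Matrix (Fin 4) (Fin 4) k, h * Om = Om * h ∧ hᵀ * B * h = B ∧ IsUnit h ∧ h *ᵥ x = y := by
  obtain ⟨x', hx', hx'x, hx'Ox⟩ := exists_orth_ne_zero B Om x
  have hxx' : x ⬝ᵥ (B *ᵥ x') = 0 := by rw [pair_comm hB]; exact hx'x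
  have hxOx' : x ⬝ᵥ (B *ᵥ (Om *ᵥ x')) = 0 := by
    rw [← neg_eq_zero, ← pair_mulVec_left hherm, pair_comm hB]
    exact hx'Ox
  set S : Matrix (Fin 4) (Fin 4) k := Matrix.of fun i j => ![x, Om *ᵥ x, x', Om *ᵥ x'] j i with hSdef
  set G : Matrix (Fin 4) (Fin 4) k :=
    Matrix.diagonal ![x ⬝ᵥ (B *ᵥ x), d * (x ⬝ᵥ (B *ᵥ x)), x' ⬝ᵥ (B *ᵥ x'), d * (x' ⬝ᵥ (B *ᵥ x'))]
    with hGdef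
  have hG : Sᵀ * B * S = G := gram_adapted hB hherm hOm x x' hxx' hxOx'
  have hα : x ⬝ᵥ (B *ᵥ x) ≠ 0 := hdef x hx
  have hα' : x' ⬝ᵥ (B *ᵥ x') ≠ 0 := hdef x' hx'
  have hd0 : d ≠ 0 := by
    rintro rfl
    exact hd ⟨0, by simp⟩
  -- `S` is invertible: `det G = det S ^ 2 * det B ≠ 0`
  have hGdet : G.det ≠ 0 := by
    rw [hGdef, Matrix.det_diagonal, Fin.prod_univ_four]
    simp only [Matrix.cons_val_zero, Matrix.cons_val_one, Matrix.head_cons, Matrix.cons_val_two,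
      Matrix.cons_val_three, Matrix.tail_cons]
    exact mul_ne_zero (mul_ne_zero (mul_ne_zero hα (mul_ne_zero hd0 hα)) hα') (mul_ne_zero hd0 hα')
  have hSdet : IsUnit S.det := by
    rw [isUnit_iff_ne_zero]
    intro h0
    apply hGdet
    rw [← hG, Matrix.det_mul, Matrix.det_mul, Matrix.det_transpose, h0, zero_mul, zero_mul]
  have hSS : S * S⁻¹ = 1 := Matrix.mul_nonsing_inv S hSdet
  have hSS' : S⁻¹ * S = 1 := Matrix.nonsing_inv_mul S hSdet
  have hOmS : Om * S = S * Matrix.of ![![0, -d, 0, 0], ![1, 0, 0, 0], ![0, 0, 0, -d], ![0, 0, 1, 0]] :=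
    mul_adapted_eq hOm x x'
  -- the coordinates of `y`
  set c : Fin 4 → k := S⁻¹ *ᵥ y with hcdef
  have hyc : S *ᵥ c = y := by rw [hcdef, mulVec_mulVec, hSS, one_mulVec]
  -- the constraint `cᵀ G c = β(y, y) = β(x, x)`
  have hconstr : c 0 * c 0 * (x ⬝ᵥ (B *ᵥ x)) + d * (c 1 * c 1) * (x ⬝ᵥ (B *ᵥ x)) +
      c 2 * c 2 * (x' ⬝ᵥ (B *ᵥ x')) + d * (c 3 * c 3) * (x' ⬝ᵥ (B *ᵥ x')) = x ⬝ᵥ (B *ᵥ x) := by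
    have h1 : y ⬝ᵥ (B *ᵥ y) = c ⬝ᵥ (G *ᵥ c) := by
      rw [← hyc, ← hG]
      calc (S *ᵥ c) ⬝ᵥ (B *ᵥ (S *ᵥ c)) = (c ᵥ* Sᵀ) ⬝ᵥ (B *ᵥ (S *ᵥ c)) := by rw [vecMul_transpose]
        _ = c ⬝ᵥ (Sᵀ *ᵥ (B *ᵥ (S *ᵥ c))) := by rw [← dotProduct_mulVec]
        _ = c ⬝ᵥ ((Sᵀ * B * S) *ᵥ c) := by simp only [mulVec_mulVec, Matrix.mul_assoc]
    have h2 : c ⬝ᵥ (G *ᵥ c) = c 0 * c 0 * (x ⬝ᵥ (B *ᵥ x)) + d * (c 1 * c 1) * (x ⬝ᵥ (B *ᵥ x)) +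
        c 2 * c 2 * (x' ⬝ᵥ (B *ᵥ x')) + d * (c 3 * c 3) * (x' ⬝ᵥ (B *ᵥ x')) := by
      rw [hGdef, dotProduct_diagonal_mulVec]
      ring
    rw [← h2, ← h1]
    exact hxy.symm
  set ν₁ : k := -(c 2 * (x' ⬝ᵥ (B *ᵥ x'))) / (x ⬝ᵥ (B *ᵥ x)) with hν₁def
  set ν₂ : k := c 3 * (x' ⬝ᵥ (B *ᵥ x')) / (x ⬝ᵥ (B *ᵥ x)) with hν₂def
  have hν₁ : ν₁ * (x ⬝ᵥ (B *ᵥ x)) = -(c 2 * (x' ⬝ᵥ (B *ᵥ x'))) := by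
    rw [hν₁def, div_mul_cancel₀ _ hα]
  have hν₂ : ν₂ * (x ⬝ᵥ (B *ᵥ x)) = c 3 * (x' ⬝ᵥ (B *ᵥ x')) := by
    rw [hν₂def, div_mul_cancel₀ _ hα]
  set R : Matrix (Fin 4) (Fin 4) k := Matrix.of
    ![![c 0, -(d * c 1), ν₁, -(d * ν₂)], ![c 1, c 0, ν₂, ν₁], ![c 2, -(d * c 3), c 0, d * c 1],
      ![c 3, c 2, -(c 1), c 0]] with hRdef
  have hRG : Rᵀ * G * R = G := witt_isometry hα hconstr hν₁ hν₂
  have hRJ : R * Matrix.of ![![0, -d, 0, 0], ![1, 0, 0, 0], ![0, 0, 0, -d], ![0, 0, 1, 0]] =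
      Matrix.of ![![0, -d, 0, 0], ![1, 0, 0, 0], ![0, 0, 0, -d], ![0, 0, 1, 0]] * R :=
    witt_comm_J _ _ _ _ _ _ _
  have hRc : R *ᵥ Pi.single 0 1 = c := by
    rw [mulVec_single_one]
    ext i
    fin_cases i <;> simp [R]
  have hcan : ∀ X : Matrix (Fin 4) (Fin 4) k, S⁻¹ * (S * X) = X := fun X => by
    rw [← Matrix.mul_assoc, hSS', Matrix.one_mul]
  have hcanT : ∀ X : Matrix (Fin 4) (Fin 4) k, Sᵀ * (S⁻¹ᵀ * X) = X := fun X => by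
    rw [← Matrix.mul_assoc, ← Matrix.transpose_mul, hSS', Matrix.transpose_one, Matrix.one_mul]
  -- `R` is invertible: `det G = det R ^ 2 * det G`
  have hRdet : IsUnit R.det := by
    rw [isUnit_iff_ne_zero]
    intro h0
    apply hGdet
    rw [← hRG, Matrix.det_mul, Matrix.det_mul, h0, mul_zero]
  refine ⟨S * R * S⁻¹, ?_, ?_, ?_, ?_⟩
  · have hOm' : Om = S * Matrix.of ![![0, -d, 0, 0], ![1, 0, 0, 0], ![0, 0, 0, -d], ![0, 0, 1, 0]] * S⁻¹ := by
      rw [← hOmS, Matrix.mul_assoc, hSS, Matrix.mul_one]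
    rw [hOm']
    simp only [Matrix.mul_assoc, hcan]
    rw [← Matrix.mul_assoc R, hRJ, Matrix.mul_assoc]
  · have hB' : B = S⁻¹ᵀ * G * S⁻¹ := by
      rw [← hG]
      calc B = (S⁻¹ᵀ * Sᵀ) * B * (S * S⁻¹) := by
            rw [← Matrix.transpose_mul, hSS, Matrix.transpose_one, Matrix.one_mul, Matrix.mul_one]
        _ = S⁻¹ᵀ * (Sᵀ * B * S) * S⁻¹ := by simp only [Matrix.mul_assoc]
    have key : S⁻¹ᵀ * (Rᵀ * (G * (R * S⁻¹))) = S⁻¹ᵀ * (G * S⁻¹) := by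
      calc S⁻¹ᵀ * (Rᵀ * (G * (R * S⁻¹))) = S⁻¹ᵀ * ((Rᵀ * G * R) * S⁻¹) := by
            simp only [Matrix.mul_assoc]
        _ = S⁻¹ᵀ * (G * S⁻¹) := by rw [hRG]
    rw [Matrix.transpose_mul, Matrix.transpose_mul, hB']
    simp only [Matrix.mul_assoc, hcan, hcanT]
    exact key
  · exact ((Matrix.isUnit_iff_isUnit_det S).mpr hSdet).mul
      ((Matrix.isUnit_iff_isUnit_det R).mpr hRdet) |>.mul
      (Matrix.isUnit_nonsing_inv_iff.mpr ((Matrix.isUnit_iff_isUnit_det S).mpr hSdet))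
  · have hx' : S *ᵥ Pi.single 0 1 = x := by
      rw [mulVec_single_one]
      rfl
    have hSx : S⁻¹ *ᵥ x = Pi.single 0 1 := by
      rw [← hx', mulVec_mulVec, hSS', one_mulVec]
    rw [← mulVec_mulVec x (S * R) S⁻¹, hSx, ← mulVec_mulVec, hRc, hyc]

end Summit.Ventures.HodgeRepro.Tier4.Line1.Rot

namespace Summit.Ventures.HodgeRepro.Tier4.Line1

open NumberField Summit.Ventures.HodgeRepro.Tier4.Common Matrix

variable {k : Type} [Field k] [NumberField k] (W : PlaneData k)

/-- (C6, M–L, t4-L1-p3 after `exists_regular_rational`) WITT FOR THE HERMITIAN PLANE: two non-zero rational row vectors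
of the same hermitian norm (`x B xᵀ = y B yᵀ` and `(xΩ) B xᵀ = (yΩ) B yᵀ`: equality of `h(x,x) = h(y,y) ∈ E′`) are
conjugate under `U(W)(k)`.  Row convention of `PlaneDefs` v0.2 (`IsGenuineRow`). -/
theorem exists_rational_vecMul_eq (hg : IsGenuineRow W) (hW : IsDefinite W) (x y : Fin 4 → k)
    (hx : x ≠ 0) (hy : y ≠ 0)
    (h1 : Matrix.vecMul x W.B ⬝ᵥ x = Matrix.vecMul y W.B ⬝ᵥ y)
    (h2 : Matrix.vecMul (Matrix.vecMul x W.Ω) W.B ⬝ᵥ x = Matrix.vecMul (Matrix.vecMul y W.Ω) W.B ⬝ᵥ y) :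
    ∃ γ : rationalPoints W, (fun i => algebraMap k (Ad k) (x i)) ᵥ* GA.mat W (γ : GA W) =
      fun i => algebraMap k (Ad k) (y i) := by
  have _hy' := hy
  have _h2' := h2
  obtain ⟨⟨d, hΩ, hd⟩, hrow, -, -, -, -⟩ := hg
  -- the column picture
  have hOm : W.Ωᵀ * W.Ωᵀ = -(d • (1 : Matrix (Fin 4) (Fin 4) k)) := by
    rw [← Matrix.transpose_mul, hΩ, Matrix.transpose_neg, Matrix.transpose_smul, Matrix.transpose_one]
  have hherm : W.Ωᵀᵀ * W.B = -(W.B * W.Ωᵀ) := by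
    rw [Matrix.transpose_transpose]
    exact hrow
  have hdef : ∀ v : Fin 4 → k, v ≠ 0 → v ⬝ᵥ (W.B *ᵥ v) ≠ 0 := fun v hv =>
    pair_self_ne_zero_of_isDefinite W hW hv
  have hxy : x ⬝ᵥ (W.B *ᵥ x) = y ⬝ᵥ (W.B *ᵥ y) := by
    have e : ∀ v : Fin 4 → k, Matrix.vecMul v W.B ⬝ᵥ v = v ⬝ᵥ (W.B *ᵥ v) := by
      intro v
      rw [← mulVec_transpose, W.B_symm, dotProduct_comm]
    rw [← e, ← e]
    exact h1
  obtain ⟨h, hhOm, hhB, hhu, hhx⟩ := Rot.exists_isometry_mulVec_eq W.B_symm hherm hOm hd hdef hx hxy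
  -- `γ := hᵀ` is a rational unitary with `x ᵥ* γ = y`
  have hγΩ : hᵀ * W.Ω = W.Ω * hᵀ := by
    rw [← Matrix.transpose_transpose W.Ω, ← Matrix.transpose_mul, ← Matrix.transpose_mul, hhOm]
  have hγB : hᵀ * W.B * hᵀᵀ = W.B := by rw [Matrix.transpose_transpose]; exact hhB
  have hγu : IsUnit hᵀ := by rw [Matrix.isUnit_iff_isUnit_det, Matrix.det_transpose]; exact (Matrix.isUnit_iff_isUnit_det h).mp hhu
  set u : GL (Fin 4) k := hγu.unit with hudef
  have hu : (u : Matrix (Fin 4) (Fin 4) k) = hᵀ := hγu.unit_spec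
  set g : GL4 k := Matrix.GeneralLinearGroup.map (algebraMap k (Ad k)) u with hgdef
  have hgm : (g : M4 k) = adMat k hᵀ := by
    ext a b
    rw [hgdef]
    show (algebraMap k (Ad k)) (u a b) = (adMat k hᵀ) a b
    rw [adMat, Matrix.map_apply, ← hu]
  have hgmem : g ∈ unitaryGroup W := by
    rw [mem_unitaryGroup, hgm]
    constructor
    · rw [← adMat_mul, ← adMat_mul, hγΩ]
    · rw [← adMat_transpose, ← adMat_mul, ← adMat_mul, hγB]
  set γ : GA W := ⟨g, hgmem⟩ with hγdef
  have hγrat : γ ∈ rationalPoints W := by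
    rw [rationalPoints, Subgroup.mem_subgroupOf]
    exact ⟨u, rfl⟩
  refine ⟨⟨γ, hγrat⟩, ?_⟩
  have hmat : GA.mat W ((⟨γ, hγrat⟩ : rationalPoints W) : GA W) = adMat k hᵀ := hgm
  rw [hmat]
  have hxh : x ᵥ* hᵀ = y := by rw [vecMul_transpose, hhx]
  funext i
  have h3 := RingHom.map_vecMul (algebraMap k (Ad k)) hᵀ x i
  rw [hxh] at h3
  rw [adMat]
  exact h3.symm

end Summit.Ventures.HodgeRepro.Tier4.Line1
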